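import Literature.MathematicalPhysics.QuantumFieldTheory.Balaban1983to89.B9Eq3130GtildeGradRowClosed
import Literature.MathematicalPhysics.QuantumFieldTheory.Balaban1983to89.B9Eq347GlobalFromLocal

/-!
# `Balaban1983to89.B9Eq347G1kPiSupGradGlobal` — T. Bałaban, *Propagators for lattice gauge theories in a background field*, Commun. Math. Phys. **99** (1985)
# 389–434 [Balaban1985BackgroundPropagators] Thm 3.13 p. 426 (*«the operator G̃ … satisfies (3.42)–(3.47)»*), Thm 3.1 (3.47) p. 398 *«|G′(U)λ|_{(2+γ)}, … ≤
# B₀|λ|_{(γ)}»* with p. 398 l. 19–20 *«the global inequalities (3.47) are consequences of the local ones (3.42) and Lemma 2.1»*, and [Balaban1985Variational]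
# (117) p. 295 *«By Theorem 3.13 of [5] the norm max{|·|_{(−1)}, |∇·|_{(−2)}} of the transformation can be estimated by B₀|J|_{(−3)} + …»*: **THE GLOBAL
# SUP → SUP BOUNDS OF PRINT's `G̃_k = Δ̃_{a,k}(U)⁻¹`, OF ITS COVARIANT DIVERGENCE AND OF ITS COVARIANT GRADIENT, ONE HEIGHT-FREE CONSTANT — `∃ α₁ B` BEFORE
# `∀ n η c₀ c₁ m U`: for EVERY bond field `f` with `‖f‖_∞ ≤ M`: `‖(G̃_kf)(b)‖ ≤ B·M`, `‖(D*_UG̃_kf)(y)‖ ≤ B·M`, `‖(D_U(G̃_kf)_μ)(b)‖ ≤ B·M`, `‖(∇_UG̃_kf)(b,μ)‖ ≤ B·M`**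
# — the local rows of `B9Eq3130GtildeGradRowClosed.exists_local_rows_G1kPi` (this lineage, the (T4′) END of the right-grouped (3.130) transfer) summed over the
# source blocks by ne9-leaf-03's (G) `B9Eq347GlobalFromLocal.norm_apply_le_of_local` with the VOLUME-FREE row constant `K_d(δ)` of `torusSum_le` — the two
# `L^∞ → L^∞` letters the (117) socket `B11Eq117TransformationNormComp.norm_toCLM115_le_of_comp` consumes, now for print's `G̃` instead of `G₀ = G₁,k`
# (`B9Eq347G1kSupGradGlobal`, gen 96, is the template — credited, followed line by line)

statement-level skeleton of published theorems with citation tags; proofs where landed; nothing here is a claim about the Yang–Mills mass gap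

CITATION HEADER (lean-in-tree rule).  Audit cell `pub-balaban`, sub-cell `t4`, BINDER row NE9; filed by the NE9 BINDER-row OWNER lineage `b2b-balaban-t4-ne9-p1`
(gen 97).  Imports this lineage's `B9Eq3130GtildeGradRowClosed` and ne9-leaf-03's (G) `B9Eq347GlobalFromLocal`.  SOURCE READ first-hand in the held text layer
[Balaban1985BackgroundPropagators] (`paper:balaban1985-cmp99-background-propagators`, journal page = PDF page + 388): p. 397 (3.42); p. 398 (3.47) and l. 17–20;
p. 421 (3.130); p. 426 Thm 3.13; [Balaban1985Variational] p. 294 (115), p. 295 (117).  Print's multi-level weights (3.41) are NOT reproduced — ONE level on top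
(`a ≡ 1`, `ω ≡ 1` in (G)'s letters); [folklore] summation BY NAME.

WHAT IS PROVED (sorry-free; proof lane — 0 `def`; [folklore]).  **`exists_global_rows_G1kPi`** — `∃ α₁ B, 0 < α₁ ∧ 0 ≤ B ∧ ∀ ⟨the binder block of
`exists_local_rows_G1kPi` VERBATIM up to `hJ`: (E2)'s block, `hpos`, `hposπ`, `hc₀ : c₀ = η^d`, `hJ : ‖J‖ ≤ α`⟩ (f : BondL2K) (M) (0 ≤ M) (‖f(b)‖ ≤ M) (μ) (b) (y),
‖(G̃_kf)(b)‖ ≤ B·M ∧ ‖(D*_UG̃_kf)(y)‖ ≤ B·M ∧ ‖(D_U(G̃_kf)_μ)(b)‖ ≤ B·M ∧ ‖(∇_UG̃_kf)(b,μ)‖ ≤ B·M`, `G̃_k = G1LatticeK hposπ`: the local theorem gives `(α₁, B_R, δ)`;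
`B := B_R·K_d(δ)`; each row is read on the plain bond ∕ site functions (`WL2.equiv` is the identity) and summed by (G) (`π := Π∘b₋`; outputs `Π∘b₋`, `Π`, `Π∘b₊`)
with `torusSum_le`; the `covGrad` member by `norm_covGrad_apply_le_of_slice`.
HONEST SCOPE.  Summation BY NAME; `B` symbolic and crude; ONE weight; `hposπ`, `hc₀`, `hJ` and the MODEL letters stay DISPLAYED exactly as in the local theorem;
the (117) bound proper (composition with `𝔓_k*`, `B11Eq117TransformationNormComp`, `H₁,k`) is NOT here, nor the GRADIENT member of (117) (STOREY H); nothing of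
[B9] Thm 3.1∕3.3∕3.11∕3.13, (3.36), (3.130)–(3.133) is asserted, valued or discharged.  NOT NE9 (cell pub-balaban: NE9 NOT PRINTED ∕ NOT PROVED; «NE9 ⇐ the named
binders»; row WALLED ON A MODEL (O-NE9-1; #5 UNRULED); spine PROVED 0∕9; rung (B)+1 on a finite T⁴ — NOT infinite volume, NOT mass gap, NOT BetaPertH, NOT Clay;
HONEST DEPENDENCY: continuum YM on T⁴ ⇐ BetaPertH ∧ nine spine estimates (0/9 proved); BetaPertH ⇐ (D1) ∧ (D4) ∧ CAP+tail; G-an2-4 gates asym, D1 and NE2/3/4).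
NEW file; nothing modified.  Net new unproved facts: 0.
-/

noncomputable section

set_option autoImplicit false

open scoped InnerProductSpace ComplexConjugate BigOperators

namespace Literature.MathematicalPhysics.QuantumFieldTheory.Balaban1983to89.B9Eq347G1kPiSupGradGlobal

open B4Sect5Torus (TSite tdist torusSum_le)
open B4Sect5Proof (latticeConst latticeConst_nonneg)
open B9SectCLatticeCarrier (Bond bpos btgt unshift)
open B9Eq311L2Pairing (WL2)
open B9Eq33CovDerivVector (covGrad)
open B9Eq319QprimeTorus (blockCoord)
open B7Prop1Explicit (U1 Wcx boxVec)
open B11Eq103H1Complex (SiteL2K BondL2K covDerivL2K covDivL2K G1LatticeK)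
open B9Eq310DeltaPrime (plaqHolU)
open B9Eq310HessianOperator (adTransportW)
open B9Eq315QTorus (perCfg cornerSite)
open B9Eq315QTower (towerP UlevOf)
open B9Eq316TowerFlatIsOneStep (towerP_eq_fineP_pow siteCast)
open B9Eq326OperatorTower (laplaceAk)
open B9Eq324DeltaPrimeATower (laplacePrimeAk)
open B9Eq3119DeltaPiTower (laplaceAkPi)
open B9Eq3130GtildeGradRowClosed (exists_local_rows_G1kPi)
open B9Eq347GlobalFromLocal (norm_apply_le_of_local)
open B9Eq326LocalPartTowerSliceGradientRow (norm_covGrad_apply_le_of_slice)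

variable {d : ℕ} (hd : 1 ≤ d) (L : ℕ) [NeZero L] (hL : 1 ≤ L) (hL3 : 3 ≤ L)
  {𝔸 : Type*} [NormedRing 𝔸] [NormedAlgebra ℂ 𝔸] [CompleteSpace 𝔸] [NormOneClass 𝔸] [StarRing 𝔸] [NormedStarGroup 𝔸] [StarModule ℂ 𝔸]
  {W : Type*} [NormedAddCommGroup W] [InnerProductSpace ℂ W] [FiniteDimensional ℂ W] (φ : W ≃ₗ[ℂ] 𝔸)
  {Mφ Mφ' : ℝ} (hMφ : 0 ≤ Mφ) (hMφ' : 0 ≤ Mφ') (hφ : ∀ w, ‖φ w‖ ≤ Mφ * ‖w‖) (hφ' : ∀ X, ‖φ.symm X‖ ≤ Mφ' * ‖X‖) (hstar : ∀ X : 𝔸, ‖star X‖ ≤ ‖X‖)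
  {a : ℝ} (ha : 0 < a) {a' : ℝ} (ha' : 0 < a') {ϱ : ℝ} (hϱ0 : 0 ≤ ϱ) (hϱ1 : ϱ < 1)
  (τ : 𝔸 →ₗ[ℂ] ℂ) {Cτ : ℝ} (hτ : ∀ X, ‖τ X‖ ≤ Cτ * ‖X‖) (hCτ : 0 ≤ Cτ) {Mτ : ℝ} (hτm : ∀ X Y : 𝔸, ‖τ (X * Y)‖ ≤ Mτ * ‖X‖ * ‖Y‖) (hMτ : 0 ≤ Mτ)
  {ρw : ℝ} (hρw : 0 ≤ ρw)
  (hτ₁ : ∀ X : 𝔸, τ (star X) = conj (τ X)) (hτ₂ : ∀ X Y : 𝔸, τ (X * Y) = τ (Y * X)) (hφτ : ∀ X Y : 𝔸, ⟪φ.symm X, φ.symm Y⟫_ℂ = τ (star X * Y))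
  (AQ : ℝ)

set_option maxHeartbeats 400000 in -- the ≈ 50-binder supplier read three times: the final defeq assembly exceeds the default budget
include hd hL hL3 hMφ hMφ' hφ hφ' hstar ha ha' hϱ0 hϱ1 hτ hCτ hτm hMτ hρw hτ₁ hτ₂ hφτ in
/-- **THE GLOBAL SUP → SUP BOUNDS OF `G̃_k`, `D*_UG̃_k`, `∇_UG̃_k`, ONE HEIGHT-FREE CONSTANT** ((3.47) from (3.42) *«and Lemma 2.1»* for print's `G̃` of Thm 3.13 at
the tower's top level; the `L^∞ → L^∞` letters (117) asks of `𝔊̃_k`'s propagator).  For every height, spacing on the diagonal, period, background of the MODEL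
letters in one window `α ≤ α₁` (four members, `‖J‖ ≤ α` included), the positivity witnesses, print's weight `c₀ = η^d`, EVERY bond field `f` with `‖f‖_∞ ≤ M`,
every `μ`, bond `b`, site `y`: `‖(G̃_kf)(b)‖ ≤ B·M`, `‖(D*_UG̃_kf)(y)‖ ≤ B·M`, `‖(D_U(G̃_kf)_μ)(b)‖ ≤ B·M`, `‖(∇_UG̃_kf)(b,μ)‖ ≤ B·M`.
[cite: Balaban1985BackgroundPropagators, Thm 3.13 p.426, Thm 3.1 (3.47) p.398, (3.42) p.397, (3.130) p.421; Balaban1985Variational, (115) p.294, (117) p.295]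
[cite: Balaban1984PropagatorsII, Lemma 2.1 (2.61) p.234] -/
theorem exists_global_rows_G1kPi :
    ∃ α₁ B : ℝ, 0 < α₁ ∧ 0 ≤ B ∧
      ∀ (n : ℕ) (η : ℝ) (_hηL : η * (L : ℝ) ^ (n + 1) = 1) (c₀ c₁ : ℝ) [Fact (0 < c₀)] [Fact (0 < c₁)]
        (_hw : c₀ * ((L : ℝ) ^ (n + 1)) ^ d = c₁) (_hρ : |η| ^ d / c₀ ≤ ρw) (m : Fin d → ℕ) [∀ i, NeZero (m i)] (_hm : ∀ i, 1 ≤ m i)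
        (U : Bond d (towerP L m (n + 1)) → 𝔸ˣ) (αU : ℕ → ℝ) (_hα0 : ∀ j, 0 ≤ αU j) (hα1 : ∀ j, αU j ≤ 1 / 64)
        (hU1 : ∀ (j : ℕ) (x : B7Prop1Explicit.Site d) (k : Fin d), perCfg (towerP L m (j + 1)) (UlevOf L m (n + 1) U j) x k ∈ U1 𝔸)
        (hreg : ∀ (j : ℕ) (y : TSite d (towerP L m j)) (k : Fin d) (ρ' : Fin d → Fin L),
          ‖((Wcx L (perCfg (towerP L m (j + 1)) (UlevOf L m (n + 1) U j)) (cornerSite L y) k (boxVec L ρ') : 𝔸ˣ) : 𝔸) - 1‖ ≤ αU j)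
        (εU : ℕ → ℝ) (_hεU : ∀ j, 0 ≤ εU j) (_hUε : ∀ (j : ℕ) (b : Bond d (towerP L m (j + 1))), ‖(UlevOf L m (n + 1) U j b : 𝔸) - 1‖ ≤ εU j)
        (_hLb : ∀ (j : ℕ) (b : Bond d (towerP L m (j + 1))), UlevOf L m (n + 1) U j b ∈ U1 𝔸)
        (α : ℝ) (_hα : 0 ≤ α) (_hαle : α ≤ α₁)
        (hUst : ∀ b, star (U b : 𝔸) = (((U b)⁻¹ : 𝔸ˣ) : 𝔸)) (_hUb : ∀ b, U b ∈ U1 𝔸) (_hUη : ∀ b, ‖(U b : 𝔸) - 1‖ ≤ α * η)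
        (_hpl : ∀ p : B9SectCLatticeCarrier.Plaq d (towerP L m (n + 1)), ‖(plaqHolU U p : 𝔸) - 1‖ ≤ α * η ^ 2)
        (_hUgrad : ∀ (x : TSite d (towerP L m (n + 1))) (μ : Fin d), ‖(U (x, μ) : 𝔸) - U (unshift μ x, μ)‖ ≤ α * η ^ 2)
        (_hRlev : ∀ (j : ℕ) (b : Bond d (towerP L m (j + 1))) (w : W), ‖adTransportW φ (UlevOf L m (n + 1) U j) b w‖ ≤ ‖w‖)
        (_hεg : ∀ j < n + 1, εU j ≤ α * ϱ ^ j) (_hAQ : ∑ j ∈ Finset.range (n + 1), αU j ≤ AQ)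
        (hpos' : ∀ x : SiteL2K ℂ d (towerP L m (n + 1)) c₀ W, x ≠ 0 → 0 < RCLike.re ⟪x, laplacePrimeAk L m n φ η U a' (c₁ := c₁) x⟫_ℂ)
        (hpos : ∀ x : BondL2K ℂ d (towerP L m (n + 1)) c₀ W, x ≠ 0 →
          0 < RCLike.re ⟪x, laplaceAk L m n φ η U hL αU hα1 hU1 hreg τ (c₀ := c₀) (c₁ := c₁) a x⟫_ℂ)
        (hposπ : ∀ x : BondL2K ℂ d (towerP L m (n + 1)) c₀ W, x ≠ 0 →
          0 < RCLike.re ⟪x, laplaceAkPi L m n φ τ η U a' hpos' hL αU hα1 hU1 hreg (c₁ := c₁) a x⟫_ℂ)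
        (_hc₀ : c₀ = η ^ d)
        (_hJ : ∀ (μ : Fin d) (y : TSite d (towerP L m (n + 1))),
          ‖B9Eq39Adjoint.J (fun μ => B9Eq33CovDerivVector.shiftEquiv μ) (fun μ y => U (y, μ)) η μ y‖ ≤ α)
        (f : BondL2K ℂ d (towerP L m (n + 1)) c₀ W) (M : ℝ) (_hM : 0 ≤ M)
        (_hfM : ∀ b, ‖WL2.equiv ℂ (fun _ : Bond d (towerP L m (n + 1)) => c₀) W f b‖ ≤ M) (μ : Fin d) (b : Bond d (towerP L m (n + 1)))
        (y : TSite d (towerP L m (n + 1))),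
        ‖WL2.equiv ℂ (fun _ : Bond d (towerP L m (n + 1)) => c₀) W (G1LatticeK hposπ f) b‖ ≤ B * M ∧
          ‖WL2.equiv ℂ (fun _ : TSite d (towerP L m (n + 1)) => c₀) W (covDivL2K ℂ c₀ ((η : ℂ))⁻¹ (adTransportW φ fun bb => (U bb)⁻¹)
              (G1LatticeK hposπ f)) y‖ ≤ B * M ∧
          ‖WL2.equiv ℂ (fun _ : Bond d (towerP L m (n + 1)) => c₀) W (covDerivL2K ℂ c₀ ((η : ℂ))⁻¹ (adTransportW φ U)
              ((WL2.equiv ℂ (fun _ : TSite d (towerP L m (n + 1)) => c₀) W).symm fun y' =>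
                WL2.equiv ℂ (fun _ : Bond d (towerP L m (n + 1)) => c₀) W (G1LatticeK hposπ f) (y', μ))) b‖ ≤ B * M ∧
          ‖covGrad ((η : ℂ))⁻¹ (adTransportW φ U) (WL2.equiv ℂ (fun _ : Bond d (towerP L m (n + 1)) => c₀) W (G1LatticeK hposπ f)) (b, μ)‖ ≤ B * M := by
  classical
  obtain ⟨αR, BR, δR, hαR, hBR, hδR, HR⟩ := exists_local_rows_G1kPi hd L hL hL3 φ hMφ hMφ' hφ hφ' hstar ha ha' hϱ0 hϱ1 τ hτ hCτ hτm hMτ hρw hτ₁ hτ₂ hφτ AQ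
  have hK : 0 ≤ latticeConst d δR := latticeConst_nonneg d hδR.le
  refine ⟨αR, BR * latticeConst d δR, hαR, by positivity, ?_⟩
  intro n η hηL c₀ c₁ _ _ hw hρ m _ hm U αU hα0 hα1 hU1 hreg εU hεU hUε hLb α hα hαle hUst hUb hUη hpl hUgrad hRlev hεg hAQ hpos' hpos hposπ hc₀ hJ
    f M hM0 hfM μ b y
  have Hk := HR n η hηL c₀ c₁ hw hρ m hm U αU hα0 hα1 hU1 hreg εU hεU hUε hLb α hα hαle hUst hUb hUη hpl hUgrad hRlev hεg hAQ hpos' hpos hposπ hc₀ hJ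
  -- the three maps read on the plain bond ∕ site functions
  obtain ⟨TV, hTV⟩ : ∃ T : (Bond d (towerP L m (n + 1)) → W) →ₗ[ℂ] (Bond d (towerP L m (n + 1)) → W),
      ∀ g x, T g x = WL2.equiv ℂ (fun _ : Bond d (towerP L m (n + 1)) => c₀) W
        (G1LatticeK hposπ ((WL2.equiv ℂ (fun _ : Bond d (towerP L m (n + 1)) => c₀) W).symm g)) x :=
    ⟨(WL2.linearEquiv ℂ ℂ (fun _ : Bond d (towerP L m (n + 1)) => c₀)).toLinearMap ∘ₗ G1LatticeK hposπ ∘ₗ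
      (WL2.linearEquiv ℂ ℂ (fun _ : Bond d (towerP L m (n + 1)) => c₀)).symm.toLinearMap, fun _ _ => rfl⟩
  obtain ⟨TS, hTS⟩ : ∃ T : (Bond d (towerP L m (n + 1)) → W) →ₗ[ℂ] (TSite d (towerP L m (n + 1)) → W),
      ∀ g x, T g x = WL2.equiv ℂ (fun _ : TSite d (towerP L m (n + 1)) => c₀) W
        (covDivL2K ℂ c₀ ((η : ℂ))⁻¹ (adTransportW φ fun bb => (U bb)⁻¹)
          (G1LatticeK hposπ ((WL2.equiv ℂ (fun _ : Bond d (towerP L m (n + 1)) => c₀) W).symm g))) x :=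
    ⟨(WL2.linearEquiv ℂ ℂ (fun _ : TSite d (towerP L m (n + 1)) => c₀)).toLinearMap ∘ₗ
      covDivL2K ℂ c₀ ((η : ℂ))⁻¹ (adTransportW φ fun bb => (U bb)⁻¹) ∘ₗ G1LatticeK hposπ ∘ₗ
      (WL2.linearEquiv ℂ ℂ (fun _ : Bond d (towerP L m (n + 1)) => c₀)).symm.toLinearMap, fun _ _ => rfl⟩
  obtain ⟨TD, hTD⟩ : ∃ T : (Bond d (towerP L m (n + 1)) → W) →ₗ[ℂ] (Bond d (towerP L m (n + 1)) → W),
      ∀ g x, T g x = WL2.equiv ℂ (fun _ : Bond d (towerP L m (n + 1)) => c₀) W (covDerivL2K ℂ c₀ ((η : ℂ))⁻¹ (adTransportW φ U)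
        ((WL2.equiv ℂ (fun _ : TSite d (towerP L m (n + 1)) => c₀) W).symm fun y' =>
          WL2.equiv ℂ (fun _ : Bond d (towerP L m (n + 1)) => c₀) W
            (G1LatticeK hposπ ((WL2.equiv ℂ (fun _ : Bond d (towerP L m (n + 1)) => c₀) W).symm g)) (y', μ))) x :=
    ⟨(WL2.linearEquiv ℂ ℂ (fun _ : Bond d (towerP L m (n + 1)) => c₀)).toLinearMap ∘ₗ
      (covDerivL2K ℂ c₀ ((η : ℂ))⁻¹ (adTransportW φ U) ∘ₗ
        (WL2.linearEquiv ℂ ℂ (fun _ : TSite d (towerP L m (n + 1)) => c₀)).symm.toLinearMap ∘ₗ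
        LinearMap.funLeft ℂ W (fun y' : TSite d (towerP L m (n + 1)) => ((y', μ) : Bond d (towerP L m (n + 1)))) ∘ₗ
        (WL2.linearEquiv ℂ ℂ (fun _ : Bond d (towerP L m (n + 1)) => c₀)).toLinearMap) ∘ₗ G1LatticeK hposπ ∘ₗ
      (WL2.linearEquiv ℂ ℂ (fun _ : Bond d (towerP L m (n + 1)) => c₀)).symm.toLinearMap, fun _ _ => rfl⟩
  -- their local letters
  have hlocV : ∀ (v : TSite d m) (g : Bond d (towerP L m (n + 1)) → W) (F : ℝ),
      (∀ y, blockCoord (L ^ (n + 1)) m (siteCast (towerP_eq_fineP_pow L m (n + 1)) (bpos y)) ≠ v → g y = 0) → (∀ y, ‖g y‖ ≤ F) →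
      ∀ x, ‖TV g x‖ ≤ BR * Real.exp (-(δR * tdist m (blockCoord (L ^ (n + 1)) m (siteCast (towerP_eq_fineP_pow L m (n + 1)) (bpos x))) v)) * F := by
    intro v g F hgv hgF x
    rw [hTV]
    exact (Hk v (((WL2.equiv ℂ (fun _ : Bond d (towerP L m (n + 1)) => c₀) W)).symm g) F
      (fun y hy => by rw [Equiv.apply_symm_apply]; exact hgv y hy) (fun y => by rw [Equiv.apply_symm_apply]; exact hgF y) μ x (bpos x)).1
  have hlocS : ∀ (v : TSite d m) (g : Bond d (towerP L m (n + 1)) → W) (F : ℝ),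
      (∀ y, blockCoord (L ^ (n + 1)) m (siteCast (towerP_eq_fineP_pow L m (n + 1)) (bpos y)) ≠ v → g y = 0) → (∀ y, ‖g y‖ ≤ F) →
      ∀ x, ‖TS g x‖ ≤ BR * Real.exp (-(δR * tdist m (blockCoord (L ^ (n + 1)) m (siteCast (towerP_eq_fineP_pow L m (n + 1)) x)) v)) * F := by
    intro v g F hgv hgF x
    rw [hTS]
    exact (Hk v (((WL2.equiv ℂ (fun _ : Bond d (towerP L m (n + 1)) => c₀) W)).symm g) F
      (fun y hy => by rw [Equiv.apply_symm_apply]; exact hgv y hy) (fun y => by rw [Equiv.apply_symm_apply]; exact hgF y) μ (x, μ) x).2.1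
  have hlocD : ∀ (v : TSite d m) (g : Bond d (towerP L m (n + 1)) → W) (F : ℝ),
      (∀ y, blockCoord (L ^ (n + 1)) m (siteCast (towerP_eq_fineP_pow L m (n + 1)) (bpos y)) ≠ v → g y = 0) → (∀ y, ‖g y‖ ≤ F) →
      ∀ x, ‖TD g x‖ ≤ BR * Real.exp (-(δR * tdist m (blockCoord (L ^ (n + 1)) m (siteCast (towerP_eq_fineP_pow L m (n + 1)) (btgt x))) v)) * F := by
    intro v g F hgv hgF x
    rw [hTD]
    exact (Hk v (((WL2.equiv ℂ (fun _ : Bond d (towerP L m (n + 1)) => c₀) W)).symm g) F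
      (fun y hy => by rw [Equiv.apply_symm_apply]; exact hgv y hy) (fun y => by rw [Equiv.apply_symm_apply]; exact hgF y) μ x (bpos x)).2.2.1
  -- one summation over the source blocks each (volume-free row constant)
  have hV := norm_apply_le_of_local
    (fun y : Bond d (towerP L m (n + 1)) => blockCoord (L ^ (n + 1)) m (siteCast (towerP_eq_fineP_pow L m (n + 1)) (bpos y)))
    (fun x : Bond d (towerP L m (n + 1)) => blockCoord (L ^ (n + 1)) m (siteCast (towerP_eq_fineP_pow L m (n + 1)) (bpos x)))
    (tdist m) TV hBR hlocV (fun u => torusSum_le d hm hδR u) (WL2.equiv ℂ (fun _ : Bond d (towerP L m (n + 1)) => c₀) W f) hM0 hfM b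
  have hS := norm_apply_le_of_local
    (fun y : Bond d (towerP L m (n + 1)) => blockCoord (L ^ (n + 1)) m (siteCast (towerP_eq_fineP_pow L m (n + 1)) (bpos y)))
    (fun x : TSite d (towerP L m (n + 1)) => blockCoord (L ^ (n + 1)) m (siteCast (towerP_eq_fineP_pow L m (n + 1)) x))
    (tdist m) TS hBR hlocS (fun u => torusSum_le d hm hδR u) (WL2.equiv ℂ (fun _ : Bond d (towerP L m (n + 1)) => c₀) W f) hM0 hfM y
  have hD := norm_apply_le_of_local
    (fun y : Bond d (towerP L m (n + 1)) => blockCoord (L ^ (n + 1)) m (siteCast (towerP_eq_fineP_pow L m (n + 1)) (bpos y)))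
    (fun x : Bond d (towerP L m (n + 1)) => blockCoord (L ^ (n + 1)) m (siteCast (towerP_eq_fineP_pow L m (n + 1)) (btgt x)))
    (tdist m) TD hBR hlocD (fun u => torusSum_le d hm hδR u) (WL2.equiv ℂ (fun _ : Bond d (towerP L m (n + 1)) => c₀) W f) hM0 hfM b
  rw [hTV, Equiv.symm_apply_apply] at hV
  rw [hTS, Equiv.symm_apply_apply] at hS
  rw [hTD, Equiv.symm_apply_apply] at hD
  exact ⟨hV, hS, hD, norm_covGrad_apply_le_of_slice _ _ _ b μ hD⟩

end Literature.MathematicalPhysics.QuantumFieldTheory.Balaban1983to89.B9Eq347G1kPiSupGradGlobal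

end
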